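import Literature.ModelTheory.ProofTheory.HilbertCalculus
import Literature.ModelTheory.ProofTheory.Checker

/-!
# Soundness of the arithmetised proof checker

Support file for the proof of the enumerability theorem
(`FirstOrder.Language.Theory.IsComputablyAxiomatizable.isRE`; Enderton, *A Mathematical
Introduction to Logic*, §2.5, §3.4–3.5). We give the judgements of the checker of
`Literature/ModelTheory/ProofTheory/Checker.lean` their meaning (`Holds`, `Valid`) — in terms of
the total decoders `PreTerm.ofNat`, `PreFormula.ofNat` of `GodelCoding.lean`, the Hilbert calculus
`Provable S` of `HilbertCalculus.lean` (for a set `S` of parameter-free hypotheses), the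
translations `PreTerm.ofTerm`, `PreFormula.ofBounded` of Mathlib syntax and Mathlib's Gödel
numbering — and prove that every rule preserves validity. Consequently
(`check_sound`): if some certificate for `n` is accepted (with the arity tables `arityF L`,
`arityR L` and an axiom oracle `memA` accepting, among the Gödel numbers of sentences, only those
of sentences whose translation lies in `S`), then `n` is the Gödel number of a sentence `φ` with
`Provable S (ofBounded φ)`.

## Main statements

* `sound_ltVar` … `sound_thm`: one soundness lemma per rule [folklore];
* `lineOK_sound`, `certOK_sound`, `check_sound` [folklore].

## References

* H. B. Enderton, *A Mathematical Introduction to Logic*, Academic Press (1972), §3.4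
  (arithmetization of syntax), §3.5 Thm. 35I.
-/

namespace Literature.ModelTheory.ProofTheory.PreFOL

open FirstOrder FirstOrder.Language Encodable Denumerable

section Meaning

variable (L : Language) [Encodable (Σ i, L.Functions i)] [Encodable (Σ i, L.Relations i)]
variable (S : Set PreFormula)

/-- The meaning of the judgement `⟪kind, a, b, c, d⟫`, by kind (see the rule table in
`Checker.lean`): lifts and instances of (codes of) pre-terms and pre-formulas, closedness,
freshness of a parameter, derivability from `S`, "`x` codes the translation of a Mathlib term /
argument tuple / bounded formula at depth `k` whose Gödel code (resp. coded tuple of codes, resp.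
code of the letter list) is `e`", and "`n` is the Gödel number of an `S`-derivable sentence".
[folklore] -/
def Holds : ℕ → ℕ → ℕ → ℕ → ℕ → Prop
  | 0, m, x, y, _ => PreTerm.ofNat y = (PreTerm.ofNat x).liftAt m
  | 1, m, x, y, _ => PreFormula.ofNat y = (PreFormula.ofNat x).liftAt m
  | 2, m, s, x, y => PreTerm.ofNat y = (PreTerm.ofNat x).inst m (PreTerm.ofNat s)
  | 3, m, s, x, y => PreFormula.ofNat y = (PreFormula.ofNat x).inst m (PreTerm.ofNat s)
  | 4, x, _, _, _ => (PreTerm.ofNat x).closed = true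
  | 5, x, _, _, _ => (PreTerm.ofNat x).closedTerm = true
  | 6, c, x, _, _ => c ∉ (PreTerm.ofNat x).params
  | 7, c, x, _, _ => c ∉ (PreFormula.ofNat x).params
  | 8, x, _, _, _ => Provable S (PreFormula.ofNat x)
  | 9, k, x, e, _ => ∃ t : L.Term (Empty ⊕ Fin k),
      PreTerm.ofTerm t = PreTerm.ofNat x ∧ encode t = e
  | 10, k, n, x, E => ∃ g : Fin n → L.Term (Empty ⊕ Fin k),
      (PreTerm.ofFn fun i => PreTerm.ofTerm (g i)) = PreTerm.ofNat x ∧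
        encode (List.ofFn fun i => encode (g i)) = E
  | 11, k, x, e, _ => ∃ ψ : L.BoundedFormula Empty k,
      PreFormula.ofBounded ψ = PreFormula.ofNat x ∧ encode (formulaLetters ψ) = e
  | 12, n, _, _, _ => ∃ φ : L.Sentence, encode φ = n ∧ Provable S (PreFormula.ofBounded φ)
  | _, _, _, _, _ => False

/-- A natural is a *valid judgement* if, read as `⟪kind, a, b, c, d⟫`, it holds. [folklore] -/
def Valid (p : ℕ) : Prop := Holds L S (jK p) (jA p) (jB p) (jC p) (jD p)

/-- Validity of an explicit judgement numeral. [folklore] -/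
@[simp] theorem valid_Jn {k a b c d : ℕ} : Valid L S (Jn k a b c d) ↔ Holds L S k a b c d := by
  simp [Valid]

/-- A pure rule is *sound* if it leads from valid premises to a valid judgement. [folklore] -/
def RuleSound (r : Rule) : Prop :=
  ∀ prev line : List ℕ, (∀ p ∈ prev, Valid L S p) → r.ok prev line = true → Valid L S (line.getI 0)

end Meaning

/-! ### Soundness of the individual rules -/

section RuleSoundness

variable {L : Language} [Encodable (Σ i, L.Functions i)] [Encodable (Σ i, L.Relations i)]
variable {S : Set PreFormula}

open Rules

/-! #### Lifting -/

/-- Soundness of `ltVar`. [folklore] -/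
theorem sound_ltVar : RuleSound L S ltVar := by
  intro prev line _ h
  simp only [ltVar, Rule.ok, premsOK, eqsOK, Bool.true_and, Bool.and_true, beq_iff_eq, Tm.eval_jn,
    Tm.eval_varT, Tm.eval_fld, Tm.eval_cst, Tm.eval_add, Tm.eval_iteLt] at h
  rw [h, valid_Jn]; simp only [Holds]
  split_ifs with h1 <;> simp [PreTerm.liftAt, h1]

/-- Soundness of `ltParam`. [folklore] -/
theorem sound_ltParam : RuleSound L S ltParam := by
  intro prev line _ h
  simp only [ltParam, Rule.ok, premsOK, eqsOK, Bool.true_and, Bool.and_true, beq_iff_eq, Tm.eval_jn,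
    Tm.eval_paramT, Tm.eval_fld, Tm.eval_cst] at h
  rw [h, valid_Jn]; simp only [Holds]
  simp [PreTerm.liftAt]

/-- Soundness of `ltFunc`. [folklore] -/
theorem sound_ltFunc : RuleSound L S ltFunc := by
  intro prev line hprev h
  simp only [ltFunc, Rule.ok, premsOK, eqsOK, Bool.and_eq_true, Bool.true_and, Bool.and_true,
    decide_eq_true_eq, beq_iff_eq, Tm.eval_jn, Tm.eval_kd, Tm.eval_p1, Tm.eval_p2, Tm.eval_p3,
    Tm.eval_funcT, Tm.eval_fld, Tm.eval_cst, zero_add] at h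
  obtain ⟨hp, hk, h0⟩ := h
  have hv := hprev _ hp
  rw [Valid, hk] at hv
  simp only [Holds] at hv
  rw [h0, valid_Jn]; simp only [Holds]
  simp [PreTerm.liftAt, hv]

/-- Soundness of `ltNil`. [folklore] -/
theorem sound_ltNil : RuleSound L S ltNil := by
  intro prev line _ h
  simp only [ltNil, Rule.ok, premsOK, eqsOK, Bool.true_and, Bool.and_true, beq_iff_eq, Tm.eval_jn,
    Tm.eval_fld, Tm.eval_cst] at h
  rw [h, valid_Jn]; simp only [Holds]
  simp [PreTerm.liftAt]

/-- Soundness of `ltCons`. [folklore] -/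
theorem sound_ltCons : RuleSound L S ltCons := by
  intro prev line hprev h
  simp only [ltCons, Rule.ok, premsOK, eqsOK, Bool.and_eq_true, Bool.true_and, Bool.and_true,
    decide_eq_true_eq, beq_iff_eq, Tm.eval_jn, Tm.eval_kd, Tm.eval_p1, Tm.eval_p2, Tm.eval_p3,
    Tm.eval_consT, Tm.eval_fld, Tm.eval_cst, and_assoc, zero_add, Nat.reduceAdd] at h
  obtain ⟨hp, hq, hk, hk', hm, h0⟩ := h
  have hv := hprev _ hp
  rw [Valid, hk] at hv
  simp only [Holds] at hv
  have hw := hprev _ hq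
  rw [Valid, hk'] at hw
  simp only [Holds] at hw
  rw [hm] at hw
  rw [h0, valid_Jn]; simp only [Holds]
  simp [PreTerm.liftAt, hv, hw]

/-- Soundness of `lfFalsum`. [folklore] -/
theorem sound_lfFalsum : RuleSound L S lfFalsum := by
  intro prev line _ h
  simp only [lfFalsum, Rule.ok, premsOK, eqsOK, Bool.true_and, Bool.and_true, beq_iff_eq,
    Tm.eval_jn, Tm.eval_fld, Tm.eval_cst] at h
  rw [h, valid_Jn]; simp only [Holds]
  simp [PreFormula.liftAt]

/-- Soundness of `lfEqual`. [folklore] -/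
theorem sound_lfEqual : RuleSound L S lfEqual := by
  intro prev line hprev h
  simp only [lfEqual, Rule.ok, premsOK, eqsOK, Bool.and_eq_true, Bool.true_and, Bool.and_true,
    decide_eq_true_eq, beq_iff_eq, Tm.eval_jn, Tm.eval_kd, Tm.eval_p1, Tm.eval_p2, Tm.eval_p3,
    Tm.eval_equalT, Tm.eval_fld, Tm.eval_cst, and_assoc, zero_add, Nat.reduceAdd] at h
  obtain ⟨hp, hq, hk, hk', hm, h0⟩ := h
  have hv := hprev _ hp
  rw [Valid, hk] at hv
  simp only [Holds] at hv
  have hw := hprev _ hq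
  rw [Valid, hk'] at hw
  simp only [Holds] at hw
  rw [hm] at hw
  rw [h0, valid_Jn]; simp only [Holds]
  simp [PreFormula.liftAt, hv, hw]

/-- Soundness of `lfRel`. [folklore] -/
theorem sound_lfRel : RuleSound L S lfRel := by
  intro prev line hprev h
  simp only [lfRel, Rule.ok, premsOK, eqsOK, Bool.and_eq_true, Bool.true_and, Bool.and_true,
    decide_eq_true_eq, beq_iff_eq, Tm.eval_jn, Tm.eval_kd, Tm.eval_p1, Tm.eval_p2, Tm.eval_p3,
    Tm.eval_relT, Tm.eval_fld, Tm.eval_cst, zero_add] at h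
  obtain ⟨hp, hk, h0⟩ := h
  have hv := hprev _ hp
  rw [Valid, hk] at hv
  simp only [Holds] at hv
  rw [h0, valid_Jn]; simp only [Holds]
  simp [PreFormula.liftAt, hv]

/-- Soundness of `lfImp`. [folklore] -/
theorem sound_lfImp : RuleSound L S lfImp := by
  intro prev line hprev h
  simp only [lfImp, Rule.ok, premsOK, eqsOK, Bool.and_eq_true, Bool.true_and, Bool.and_true,
    decide_eq_true_eq, beq_iff_eq, Tm.eval_jn, Tm.eval_kd, Tm.eval_p1, Tm.eval_p2, Tm.eval_p3,
    Tm.eval_impT, Tm.eval_fld, Tm.eval_cst, and_assoc, zero_add, Nat.reduceAdd] at h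
  obtain ⟨hp, hq, hk, hk', hm, h0⟩ := h
  have hv := hprev _ hp
  rw [Valid, hk] at hv
  simp only [Holds] at hv
  have hw := hprev _ hq
  rw [Valid, hk'] at hw
  simp only [Holds] at hw
  rw [hm] at hw
  rw [h0, valid_Jn]; simp only [Holds]
  simp [PreFormula.liftAt, hv, hw]

/-- Soundness of `lfAll`. [folklore] -/
theorem sound_lfAll : RuleSound L S lfAll := by
  intro prev line hprev h
  simp only [lfAll, Rule.ok, premsOK, eqsOK, Bool.and_eq_true, Bool.true_and, Bool.and_true,
    decide_eq_true_eq, beq_iff_eq, Tm.eval_jn, Tm.eval_kd, Tm.eval_p1, Tm.eval_p2, Tm.eval_p3,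
    Tm.eval_allT, Tm.eval_fld, Tm.eval_cst, zero_add] at h
  obtain ⟨hp, hk, h0⟩ := h
  have hv := hprev _ hp
  rw [Valid, hk] at hv
  simp only [Holds] at hv
  rw [h0, valid_Jn]; simp only [Holds]
  simp [PreFormula.liftAt, hv]

/-! #### Instances -/

/-- Soundness of `itVar`. [folklore] -/
theorem sound_itVar : RuleSound L S itVar := by
  intro prev line _ h
  simp only [itVar, Rule.ok, premsOK, eqsOK, Bool.true_and, Bool.and_true, beq_iff_eq, Tm.eval_jn,
    Tm.eval_varT, Tm.eval_fld, Tm.eval_cst, Tm.eval_sub, Tm.eval_iteLt, Tm.eval_iteEq] at h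
  rw [h, valid_Jn]; simp only [Holds]
  split_ifs with h1 h2
  · simp [PreTerm.inst, h1]
  · simp [PreTerm.inst, h2]
  · simp [PreTerm.inst, h1, h2]

/-- Soundness of `itParam`. [folklore] -/
theorem sound_itParam : RuleSound L S itParam := by
  intro prev line _ h
  simp only [itParam, Rule.ok, premsOK, eqsOK, Bool.true_and, Bool.and_true, beq_iff_eq, Tm.eval_jn,
    Tm.eval_paramT, Tm.eval_fld] at h
  rw [h, valid_Jn]; simp only [Holds]
  simp [PreTerm.inst]

/-- Soundness of `itFunc`. [folklore] -/
theorem sound_itFunc : RuleSound L S itFunc := by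
  intro prev line hprev h
  simp only [itFunc, Rule.ok, premsOK, eqsOK, Bool.and_eq_true, Bool.true_and, Bool.and_true,
    decide_eq_true_eq, beq_iff_eq, Tm.eval_jn, Tm.eval_kd, Tm.eval_p1, Tm.eval_p2, Tm.eval_p3,
    Tm.eval_p4, Tm.eval_funcT, Tm.eval_fld, Tm.eval_cst, zero_add] at h
  obtain ⟨hp, hk, h0⟩ := h
  have hv := hprev _ hp
  rw [Valid, hk] at hv
  simp only [Holds] at hv
  rw [h0, valid_Jn]; simp only [Holds]
  simp [PreTerm.inst, hv]

/-- Soundness of `itNil`. [folklore] -/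
theorem sound_itNil : RuleSound L S itNil := by
  intro prev line _ h
  simp only [itNil, Rule.ok, premsOK, eqsOK, Bool.true_and, Bool.and_true, beq_iff_eq, Tm.eval_jn,
    Tm.eval_fld, Tm.eval_cst] at h
  rw [h, valid_Jn]; simp only [Holds]
  simp [PreTerm.inst]

/-- Soundness of `itCons`. [folklore] -/
theorem sound_itCons : RuleSound L S itCons := by
  intro prev line hprev h
  simp only [itCons, Rule.ok, premsOK, eqsOK, Bool.and_eq_true, Bool.true_and, Bool.and_true,
    decide_eq_true_eq, beq_iff_eq, Tm.eval_jn, Tm.eval_kd, Tm.eval_p1, Tm.eval_p2, Tm.eval_p3,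
    Tm.eval_p4, Tm.eval_consT, Tm.eval_fld, Tm.eval_cst, and_assoc, zero_add, Nat.reduceAdd] at h
  obtain ⟨hp, hq, hk, hk', hm, hs, h0⟩ := h
  have hv := hprev _ hp
  rw [Valid, hk] at hv
  simp only [Holds] at hv
  have hw := hprev _ hq
  rw [Valid, hk'] at hw
  simp only [Holds] at hw
  rw [hm, hs] at hw
  rw [h0, valid_Jn]; simp only [Holds]
  simp [PreTerm.inst, hv, hw]

/-- Soundness of `ifFalsum`. [folklore] -/
theorem sound_ifFalsum : RuleSound L S ifFalsum := by
  intro prev line _ h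
  simp only [ifFalsum, Rule.ok, premsOK, eqsOK, Bool.true_and, Bool.and_true, beq_iff_eq,
    Tm.eval_jn, Tm.eval_fld, Tm.eval_cst] at h
  rw [h, valid_Jn]; simp only [Holds]
  simp [PreFormula.inst]

/-- Soundness of `ifEqual`. [folklore] -/
theorem sound_ifEqual : RuleSound L S ifEqual := by
  intro prev line hprev h
  simp only [ifEqual, Rule.ok, premsOK, eqsOK, Bool.and_eq_true, Bool.true_and, Bool.and_true,
    decide_eq_true_eq, beq_iff_eq, Tm.eval_jn, Tm.eval_kd, Tm.eval_p1, Tm.eval_p2, Tm.eval_p3,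
    Tm.eval_p4, Tm.eval_equalT, Tm.eval_fld, Tm.eval_cst, and_assoc, zero_add, Nat.reduceAdd] at h
  obtain ⟨hp, hq, hk, hk', hm, hs, h0⟩ := h
  have hv := hprev _ hp
  rw [Valid, hk] at hv
  simp only [Holds] at hv
  have hw := hprev _ hq
  rw [Valid, hk'] at hw
  simp only [Holds] at hw
  rw [hm, hs] at hw
  rw [h0, valid_Jn]; simp only [Holds]
  simp [PreFormula.inst, hv, hw]

/-- Soundness of `ifRel`. [folklore] -/
theorem sound_ifRel : RuleSound L S ifRel := by
  intro prev line hprev h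
  simp only [ifRel, Rule.ok, premsOK, eqsOK, Bool.and_eq_true, Bool.true_and, Bool.and_true,
    decide_eq_true_eq, beq_iff_eq, Tm.eval_jn, Tm.eval_kd, Tm.eval_p1, Tm.eval_p2, Tm.eval_p3,
    Tm.eval_p4, Tm.eval_relT, Tm.eval_fld, Tm.eval_cst, zero_add] at h
  obtain ⟨hp, hk, h0⟩ := h
  have hv := hprev _ hp
  rw [Valid, hk] at hv
  simp only [Holds] at hv
  rw [h0, valid_Jn]; simp only [Holds]
  simp [PreFormula.inst, hv]

/-- Soundness of `ifImp`. [folklore] -/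
theorem sound_ifImp : RuleSound L S ifImp := by
  intro prev line hprev h
  simp only [ifImp, Rule.ok, premsOK, eqsOK, Bool.and_eq_true, Bool.true_and, Bool.and_true,
    decide_eq_true_eq, beq_iff_eq, Tm.eval_jn, Tm.eval_kd, Tm.eval_p1, Tm.eval_p2, Tm.eval_p3,
    Tm.eval_p4, Tm.eval_impT, Tm.eval_fld, Tm.eval_cst, and_assoc, zero_add, Nat.reduceAdd] at h
  obtain ⟨hp, hq, hk, hk', hm, hs, h0⟩ := h
  have hv := hprev _ hp
  rw [Valid, hk] at hv
  simp only [Holds] at hv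
  have hw := hprev _ hq
  rw [Valid, hk'] at hw
  simp only [Holds] at hw
  rw [hm, hs] at hw
  rw [h0, valid_Jn]; simp only [Holds]
  simp [PreFormula.inst, hv, hw]

/-- Soundness of `ifAll`. [folklore] -/
theorem sound_ifAll : RuleSound L S ifAll := by
  intro prev line hprev h
  simp only [ifAll, Rule.ok, premsOK, eqsOK, Bool.and_eq_true, Bool.true_and, Bool.and_true,
    decide_eq_true_eq, beq_iff_eq, Tm.eval_jn, Tm.eval_kd, Tm.eval_p1, Tm.eval_p2, Tm.eval_p3,
    Tm.eval_p4, Tm.eval_allT, Tm.eval_fld, Tm.eval_cst, zero_add] at h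
  obtain ⟨hp, hk, h0⟩ := h
  have hv := hprev _ hp
  rw [Valid, hk] at hv
  simp only [Holds] at hv
  rw [h0, valid_Jn]; simp only [Holds]
  simp [PreFormula.inst, hv]

/-! #### Closedness -/

/-- Soundness of `clParam`. [folklore] -/
theorem sound_clParam : RuleSound L S clParam := by
  intro prev line _ h
  simp only [clParam, Rule.ok, premsOK, eqsOK, Bool.true_and, Bool.and_true, beq_iff_eq, Tm.eval_jn,
    Tm.eval_paramT, Tm.eval_fld, Tm.eval_cst] at h
  rw [h, valid_Jn]; simp only [Holds]
  simp [PreTerm.closed]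

/-- Soundness of `clFunc`. [folklore] -/
theorem sound_clFunc : RuleSound L S clFunc := by
  intro prev line hprev h
  simp only [clFunc, Rule.ok, premsOK, eqsOK, Bool.and_eq_true, Bool.true_and, Bool.and_true,
    decide_eq_true_eq, beq_iff_eq, Tm.eval_jn, Tm.eval_kd, Tm.eval_p1, Tm.eval_funcT, Tm.eval_fld,
    Tm.eval_cst, zero_add] at h
  obtain ⟨hp, hk, h0⟩ := h
  have hv := hprev _ hp
  rw [Valid, hk] at hv
  simp only [Holds] at hv
  rw [h0, valid_Jn]; simp only [Holds]
  simpa [PreTerm.closed] using hv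

/-- Soundness of `clNil`. [folklore] -/
theorem sound_clNil : RuleSound L S clNil := by
  intro prev line _ h
  simp only [clNil, Rule.ok, premsOK, eqsOK, Bool.true_and, Bool.and_true, beq_iff_eq, Tm.eval_jn,
    Tm.eval_fld, Tm.eval_cst] at h
  rw [h, valid_Jn]; simp only [Holds]
  simp [PreTerm.closed]

/-- Soundness of `clCons`. [folklore] -/
theorem sound_clCons : RuleSound L S clCons := by
  intro prev line hprev h
  simp only [clCons, Rule.ok, premsOK, eqsOK, Bool.and_eq_true, Bool.true_and, Bool.and_true,
    decide_eq_true_eq, beq_iff_eq, Tm.eval_jn, Tm.eval_kd, Tm.eval_p1, Tm.eval_consT, Tm.eval_fld,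
    Tm.eval_cst, and_assoc, zero_add, Nat.reduceAdd] at h
  obtain ⟨hp, hq, hk, hk', h0⟩ := h
  have hv := hprev _ hp
  rw [Valid, hk] at hv
  simp only [Holds] at hv
  have hw := hprev _ hq
  rw [Valid, hk'] at hw
  simp only [Holds] at hw
  rw [h0, valid_Jn]; simp only [Holds]
  simp [PreTerm.closed, hv, hw]

/-- Soundness of `ctParam`. [folklore] -/
theorem sound_ctParam : RuleSound L S ctParam := by
  intro prev line _ h
  simp only [ctParam, Rule.ok, premsOK, eqsOK, Bool.true_and, Bool.and_true, beq_iff_eq, Tm.eval_jn,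
    Tm.eval_paramT, Tm.eval_fld, Tm.eval_cst] at h
  rw [h, valid_Jn]; simp only [Holds]
  simp [PreTerm.closedTerm]

/-- Soundness of `ctFunc`. [folklore] -/
theorem sound_ctFunc : RuleSound L S ctFunc := by
  intro prev line hprev h
  simp only [ctFunc, Rule.ok, premsOK, eqsOK, Bool.and_eq_true, Bool.true_and, Bool.and_true,
    decide_eq_true_eq, beq_iff_eq, Tm.eval_jn, Tm.eval_kd, Tm.eval_p1, Tm.eval_funcT, Tm.eval_fld,
    Tm.eval_cst, zero_add] at h
  obtain ⟨hp, hk, h0⟩ := h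
  have hv := hprev _ hp
  rw [Valid, hk] at hv
  simp only [Holds] at hv
  rw [h0, valid_Jn]; simp only [Holds]
  simpa [PreTerm.closedTerm] using hv

/-! #### Freshness -/

/-- Soundness of `ntVar`. [folklore] -/
theorem sound_ntVar : RuleSound L S ntVar := by
  intro prev line _ h
  simp only [ntVar, Rule.ok, premsOK, eqsOK, Bool.true_and, Bool.and_true, beq_iff_eq, Tm.eval_jn,
    Tm.eval_varT, Tm.eval_fld, Tm.eval_cst] at h
  rw [h, valid_Jn]; simp only [Holds]
  simp [PreTerm.params]

/-- Soundness of `ntParam`. [folklore] -/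
theorem sound_ntParam : RuleSound L S ntParam := by
  intro prev line _ h
  simp only [ntParam, Rule.ok, premsOK, eqsOK, Bool.and_eq_true, Bool.true_and, Bool.and_true,
    beq_iff_eq, Tm.eval_jn, Tm.eval_paramT, Tm.eval_fld, Tm.eval_cst, Tm.eval_iteEq] at h
  obtain ⟨hne, h0⟩ := h
  have hne' : line.getI 1 ≠ line.getI 2 := by
    intro e; rw [if_pos e] at hne; exact Nat.one_ne_zero hne
  rw [h0, valid_Jn]; simp only [Holds]
  simpa [PreTerm.params] using hne'

/-- Soundness of `ntFunc`. [folklore] -/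
theorem sound_ntFunc : RuleSound L S ntFunc := by
  intro prev line hprev h
  simp only [ntFunc, Rule.ok, premsOK, eqsOK, Bool.and_eq_true, Bool.true_and, Bool.and_true,
    decide_eq_true_eq, beq_iff_eq, Tm.eval_jn, Tm.eval_kd, Tm.eval_p1, Tm.eval_p2, Tm.eval_funcT,
    Tm.eval_fld, Tm.eval_cst, zero_add] at h
  obtain ⟨hp, hk, h0⟩ := h
  have hv := hprev _ hp
  rw [Valid, hk] at hv
  simp only [Holds] at hv
  rw [h0, valid_Jn]; simp only [Holds]
  simpa [PreTerm.params] using hv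

/-- Soundness of `ntNil`. [folklore] -/
theorem sound_ntNil : RuleSound L S ntNil := by
  intro prev line _ h
  simp only [ntNil, Rule.ok, premsOK, eqsOK, Bool.true_and, Bool.and_true, beq_iff_eq, Tm.eval_jn,
    Tm.eval_fld, Tm.eval_cst] at h
  rw [h, valid_Jn]; simp only [Holds]
  simp [PreTerm.params]

/-- Soundness of `ntCons`. [folklore] -/
theorem sound_ntCons : RuleSound L S ntCons := by
  intro prev line hprev h
  simp only [ntCons, Rule.ok, premsOK, eqsOK, Bool.and_eq_true, Bool.true_and, Bool.and_true,
    decide_eq_true_eq, beq_iff_eq, Tm.eval_jn, Tm.eval_kd, Tm.eval_p1, Tm.eval_p2, Tm.eval_consT,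
    Tm.eval_fld, Tm.eval_cst, and_assoc, zero_add, Nat.reduceAdd] at h
  obtain ⟨hp, hq, hk, hk', hm, h0⟩ := h
  have hv := hprev _ hp
  rw [Valid, hk] at hv
  simp only [Holds] at hv
  have hw := hprev _ hq
  rw [Valid, hk'] at hw
  simp only [Holds] at hw
  rw [hm] at hw
  rw [h0, valid_Jn]; simp only [Holds]
  simp [PreTerm.params, hv, hw]

/-- Soundness of `nfFalsum`. [folklore] -/
theorem sound_nfFalsum : RuleSound L S nfFalsum := by
  intro prev line _ h
  simp only [nfFalsum, Rule.ok, premsOK, eqsOK, Bool.true_and, Bool.and_true, beq_iff_eq,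
    Tm.eval_jn, Tm.eval_fld, Tm.eval_cst] at h
  rw [h, valid_Jn]; simp only [Holds]
  simp [PreFormula.params]

/-- Soundness of `nfEqual`. [folklore] -/
theorem sound_nfEqual : RuleSound L S nfEqual := by
  intro prev line hprev h
  simp only [nfEqual, Rule.ok, premsOK, eqsOK, Bool.and_eq_true, Bool.true_and, Bool.and_true,
    decide_eq_true_eq, beq_iff_eq, Tm.eval_jn, Tm.eval_kd, Tm.eval_p1, Tm.eval_p2, Tm.eval_equalT,
    Tm.eval_fld, Tm.eval_cst, and_assoc, zero_add, Nat.reduceAdd] at h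
  obtain ⟨hp, hq, hk, hk', hm, h0⟩ := h
  have hv := hprev _ hp
  rw [Valid, hk] at hv
  simp only [Holds] at hv
  have hw := hprev _ hq
  rw [Valid, hk'] at hw
  simp only [Holds] at hw
  rw [hm] at hw
  rw [h0, valid_Jn]; simp only [Holds]
  simp [PreFormula.params, hv, hw]

/-- Soundness of `nfRel`. [folklore] -/
theorem sound_nfRel : RuleSound L S nfRel := by
  intro prev line hprev h
  simp only [nfRel, Rule.ok, premsOK, eqsOK, Bool.and_eq_true, Bool.true_and, Bool.and_true,
    decide_eq_true_eq, beq_iff_eq, Tm.eval_jn, Tm.eval_kd, Tm.eval_p1, Tm.eval_p2, Tm.eval_relT,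
    Tm.eval_fld, Tm.eval_cst, zero_add] at h
  obtain ⟨hp, hk, h0⟩ := h
  have hv := hprev _ hp
  rw [Valid, hk] at hv
  simp only [Holds] at hv
  rw [h0, valid_Jn]; simp only [Holds]
  simpa [PreFormula.params] using hv

/-- Soundness of `nfImp`. [folklore] -/
theorem sound_nfImp : RuleSound L S nfImp := by
  intro prev line hprev h
  simp only [nfImp, Rule.ok, premsOK, eqsOK, Bool.and_eq_true, Bool.true_and, Bool.and_true,
    decide_eq_true_eq, beq_iff_eq, Tm.eval_jn, Tm.eval_kd, Tm.eval_p1, Tm.eval_p2, Tm.eval_impT,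
    Tm.eval_fld, Tm.eval_cst, and_assoc, zero_add, Nat.reduceAdd] at h
  obtain ⟨hp, hq, hk, hk', hm, h0⟩ := h
  have hv := hprev _ hp
  rw [Valid, hk] at hv
  simp only [Holds] at hv
  have hw := hprev _ hq
  rw [Valid, hk'] at hw
  simp only [Holds] at hw
  rw [hm] at hw
  rw [h0, valid_Jn]; simp only [Holds]
  simp [PreFormula.params, hv, hw]

/-- Soundness of `nfAll`. [folklore] -/
theorem sound_nfAll : RuleSound L S nfAll := by
  intro prev line hprev h
  simp only [nfAll, Rule.ok, premsOK, eqsOK, Bool.and_eq_true, Bool.true_and, Bool.and_true,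
    decide_eq_true_eq, beq_iff_eq, Tm.eval_jn, Tm.eval_kd, Tm.eval_p1, Tm.eval_p2, Tm.eval_allT,
    Tm.eval_fld, Tm.eval_cst, zero_add] at h
  obtain ⟨hp, hk, h0⟩ := h
  have hv := hprev _ hp
  rw [Valid, hk] at hv
  simp only [Holds] at hv
  rw [h0, valid_Jn]; simp only [Holds]
  simpa [PreFormula.params] using hv

/-! #### Derivability -/

/-- Soundness of `pfP1`. [folklore] -/
theorem sound_pfP1 : RuleSound L S pfP1 := by
  intro prev line _ h
  simp only [pfP1, Rule.ok, premsOK, eqsOK, Bool.true_and, Bool.and_true, beq_iff_eq, Tm.eval_jn,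
    Tm.eval_impT, Tm.eval_fld, Tm.eval_cst] at h
  rw [h, valid_Jn]; simp only [Holds]
  simpa using Provable.of_derives (Derives.p1 _ _)

/-- Soundness of `pfP2`. [folklore] -/
theorem sound_pfP2 : RuleSound L S pfP2 := by
  intro prev line _ h
  simp only [pfP2, Rule.ok, premsOK, eqsOK, Bool.true_and, Bool.and_true, beq_iff_eq, Tm.eval_jn,
    Tm.eval_impT, Tm.eval_fld, Tm.eval_cst] at h
  rw [h, valid_Jn]; simp only [Holds]
  simpa using Provable.of_derives (Derives.p2 _ _ _)

/-- Soundness of `pfP3`. [folklore] -/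
theorem sound_pfP3 : RuleSound L S pfP3 := by
  intro prev line _ h
  simp only [pfP3, Rule.ok, premsOK, eqsOK, Bool.true_and, Bool.and_true, beq_iff_eq, Tm.eval_jn,
    Tm.eval_impT, Tm.eval_fld, Tm.eval_cst] at h
  rw [h, valid_Jn]; simp only [Holds]
  simpa using Provable.of_derives (Derives.p3 _)

/-- Soundness of `pfQ1`. [folklore] -/
theorem sound_pfQ1 : RuleSound L S pfQ1 := by
  intro prev line hprev h
  simp only [pfQ1, Rule.ok, premsOK, eqsOK, Bool.and_eq_true, Bool.true_and, Bool.and_true,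
    decide_eq_true_eq, beq_iff_eq, Tm.eval_jn, Tm.eval_kd, Tm.eval_p1, Tm.eval_p2, Tm.eval_p3,
    Tm.eval_p4, Tm.eval_impT, Tm.eval_allT, Tm.eval_fld, Tm.eval_cst, and_assoc, zero_add,
    Nat.reduceAdd] at h
  obtain ⟨hp, hq, hk, hm, hk', hs, h0⟩ := h
  have hv := hprev _ hp
  rw [Valid, hk] at hv
  simp only [Holds] at hv
  have hw := hprev _ hq
  rw [Valid, hk'] at hw
  simp only [Holds] at hw
  rw [hm] at hv
  rw [hs] at hw
  rw [h0, valid_Jn]; simp only [Holds]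
  simpa [hv] using Provable.of_derives (Derives.q1 (PreFormula.ofNat (jC (line.getI 1))) hw)

/-- Soundness of `pfQ2`. [folklore] -/
theorem sound_pfQ2 : RuleSound L S pfQ2 := by
  intro prev line _ h
  simp only [pfQ2, Rule.ok, premsOK, eqsOK, Bool.true_and, Bool.and_true, beq_iff_eq, Tm.eval_jn,
    Tm.eval_impT, Tm.eval_allT, Tm.eval_fld, Tm.eval_cst] at h
  rw [h, valid_Jn]; simp only [Holds]
  simpa using Provable.of_derives (Derives.q2 _ _)

/-- Soundness of `pfQ3`. [folklore] -/
theorem sound_pfQ3 : RuleSound L S pfQ3 := by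
  intro prev line hprev h
  simp only [pfQ3, Rule.ok, premsOK, eqsOK, Bool.and_eq_true, Bool.true_and, Bool.and_true,
    decide_eq_true_eq, beq_iff_eq, Tm.eval_jn, Tm.eval_kd, Tm.eval_p1, Tm.eval_p2, Tm.eval_p3,
    Tm.eval_impT, Tm.eval_allT, Tm.eval_fld, Tm.eval_cst, zero_add] at h
  obtain ⟨hp, hk, hm, h0⟩ := h
  have hv := hprev _ hp
  rw [Valid, hk] at hv
  simp only [Holds] at hv
  rw [hm] at hv
  rw [h0, valid_Jn]; simp only [Holds]
  simpa [hv] using Provable.of_derives (Derives.q3 (PreFormula.ofNat (jB (line.getI 1))))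

/-- Soundness of `pfE1`. [folklore] -/
theorem sound_pfE1 : RuleSound L S pfE1 := by
  intro prev line _ h
  simp only [pfE1, Rule.ok, premsOK, eqsOK, Bool.true_and, Bool.and_true, beq_iff_eq, Tm.eval_jn,
    Tm.eval_equalT, Tm.eval_fld, Tm.eval_cst] at h
  rw [h, valid_Jn]; simp only [Holds]
  simpa using Provable.of_derives (Derives.e1 _)

/-- Soundness of `pfE2`. [folklore] -/
theorem sound_pfE2 : RuleSound L S pfE2 := by
  intro prev line hprev h
  simp only [pfE2, Rule.ok, premsOK, eqsOK, Bool.and_eq_true, Bool.true_and, Bool.and_true,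
    decide_eq_true_eq, beq_iff_eq, Tm.eval_jn, Tm.eval_kd, Tm.eval_p1, Tm.eval_p2, Tm.eval_p3,
    Tm.eval_p4, Tm.eval_equalT, Tm.eval_impT, Tm.eval_fld, Tm.eval_cst, and_assoc, zero_add,
    Nat.reduceAdd] at h
  obtain ⟨hp, hq, hu, hw', hk1, hm1, hk2, hm2, hx, hk3, hs3, hk4, hs4, h0⟩ := h
  have hv1 := hprev _ hp
  rw [Valid, hk1] at hv1
  simp only [Holds] at hv1
  have hv2 := hprev _ hq
  rw [Valid, hk2] at hv2
  simp only [Holds] at hv2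
  have hv3 := hprev _ hu
  rw [Valid, hk3] at hv3
  simp only [Holds] at hv3
  have hv4 := hprev _ hw'
  rw [Valid, hk4] at hv4
  simp only [Holds] at hv4
  rw [hm1] at hv1
  rw [hm2, hx] at hv2
  rw [hs3] at hv3
  rw [hs4] at hv4
  rw [h0, valid_Jn]; simp only [Holds]
  simpa [hv1, hv2] using
    Provable.of_derives (Derives.e2 (PreFormula.ofNat (jC (line.getI 1))) hv3 hv4)

/-- Soundness of `pfMP`. [folklore] -/
theorem sound_pfMP : RuleSound L S pfMP := by
  intro prev line hprev h
  simp only [pfMP, Rule.ok, premsOK, eqsOK, Bool.and_eq_true, Bool.true_and, Bool.and_true,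
    decide_eq_true_eq, beq_iff_eq, Tm.eval_jn, Tm.eval_kd, Tm.eval_p1, Tm.eval_impT, Tm.eval_fld,
    Tm.eval_cst, and_assoc, zero_add, Nat.reduceAdd] at h
  obtain ⟨hp, hq, hk, hk', hi, h0⟩ := h
  have hv := hprev _ hp
  rw [Valid, hk] at hv
  simp only [Holds] at hv
  have hw := hprev _ hq
  rw [Valid, hk'] at hw
  simp only [Holds] at hw
  rw [hi] at hv
  rw [h0, valid_Jn]; simp only [Holds]
  simp only [PreFormula.ofNat_impC] at hv
  exact hv.mp hw

/-- Soundness of `pfGen` (generalisation on a fresh constant, Enderton Thm. 24F): this is where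
the hypotheses in `S` must be parameter free. [folklore] -/
theorem sound_pfGen (hS0 : ∀ ψ ∈ S, ψ.params = ∅) : RuleSound L S pfGen := by
  intro prev line hprev h
  simp only [pfGen, Rule.ok, premsOK, eqsOK, Bool.and_eq_true, Bool.true_and, Bool.and_true,
    decide_eq_true_eq, beq_iff_eq, Tm.eval_jn, Tm.eval_kd, Tm.eval_p1, Tm.eval_p2, Tm.eval_p3,
    Tm.eval_p4, Tm.eval_paramT, Tm.eval_allT, Tm.eval_fld, Tm.eval_cst, and_assoc, zero_add,
    Nat.reduceAdd] at h
  obtain ⟨hp, hq, hu, hk1, hk2, hm, hs, hy, hk3, hc, hx, h0⟩ := h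
  have hv1 := hprev _ hp
  rw [Valid, hk1] at hv1
  simp only [Holds] at hv1
  have hv2 := hprev _ hq
  rw [Valid, hk2] at hv2
  simp only [Holds] at hv2
  have hv3 := hprev _ hu
  rw [Valid, hk3] at hv3
  simp only [Holds] at hv3
  rw [hm, hs, hy] at hv2
  rw [hc, hx] at hv3
  rw [hv2, PreTerm.ofNat_paramC] at hv1
  rw [h0, valid_Jn]; simp only [Holds]
  rw [PreFormula.ofNat_allC]
  obtain ⟨U, hU, hd⟩ := hv1
  refine ⟨U, hU, Derives.gen hd hv3 fun ψ hψ => ?_⟩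
  simp [hS0 ψ (hU ψ hψ)]

/-- Soundness of the oracle rule `pfHyp`: the oracle must accept, among Gödel numbers of
sentences, only those of sentences whose translation is a hypothesis. [folklore] -/
theorem sound_pfHyp {memA : ℕ → Bool}
    (hA : ∀ ψ : L.Sentence, memA (encode ψ) = true → PreFormula.ofBounded ψ ∈ S)
    (prev line : List ℕ) (hprev : ∀ p ∈ prev, Valid L S p) (h : pfHyp.ok prev line = true)
    (hC : memA (jC (line.getI 1)) = true) : Valid L S (line.getI 0) := by
  simp only [pfHyp, Rule.ok, premsOK, eqsOK, Bool.and_eq_true, Bool.true_and, Bool.and_true,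
    decide_eq_true_eq, beq_iff_eq, Tm.eval_jn, Tm.eval_kd, Tm.eval_p1, Tm.eval_p2, Tm.eval_fld,
    Tm.eval_cst, zero_add] at h
  obtain ⟨hp, hk, hm, h0⟩ := h
  have hv := hprev _ hp
  rw [Valid, hk] at hv
  simp only [Holds] at hv
  rw [hm] at hv
  obtain ⟨ψ, hψ, he⟩ := hv
  rw [h0, valid_Jn]; simp only [Holds]
  rw [← hψ]
  refine Provable.of_mem (hA ψ ?_)
  rwa [encode_sentence_eq, he]

/-! #### Mathlib syntax and Gödel letters -/

/-- Soundness of `mtVar`. [folklore] -/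
theorem sound_mtVar : RuleSound L S mtVar := by
  intro prev line _ h
  simp only [mtVar, Rule.ok, premsOK, eqsOK, Bool.and_eq_true, Bool.true_and, Bool.and_true,
    beq_iff_eq, Tm.eval_jn, Tm.eval_varT, Tm.eval_lsing, Tm.eval_fld, Tm.eval_cst, Tm.eval_add,
    Tm.eval_mul, Tm.eval_iteLt] at h
  obtain ⟨hlt, h0⟩ := h
  have hlt' : line.getI 2 < line.getI 1 := by
    by_contra hn; rw [if_neg hn] at hlt; exact Nat.zero_ne_one hlt
  rw [h0, valid_Jn]; simp only [Holds]
  refine ⟨Term.var (Sum.inr ⟨line.getI 2, hlt'⟩), by simp [PreTerm.ofTerm], ?_⟩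
  rw [encode_term_eq, termLetters_var]

/-- Soundness of the oracle rule `mtFunc` (the oracle is the arity table `arityF L`). [folklore] -/
theorem sound_mtFunc (prev line : List ℕ) (hprev : ∀ p ∈ prev, Valid L S p)
    (h : mtFunc.ok prev line = true) (hC : arityF L (line.getI 2) = some (jB (line.getI 1))) :
    Valid L S (line.getI 0) := by
  simp only [mtFunc, Rule.ok, premsOK, eqsOK, Bool.and_eq_true, Bool.true_and, Bool.and_true,
    decide_eq_true_eq, beq_iff_eq, Tm.eval_jn, Tm.eval_kd, Tm.eval_p1, Tm.eval_p3, Tm.eval_p4,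
    Tm.eval_funcT, Tm.eval_fld, Tm.eval_cst, Tm.eval_add, Tm.eval_mul, Tm.eval_lcons, Tm.eval_lflat,
    zero_add] at h
  obtain ⟨hp, hk, h0⟩ := h
  have hv := hprev _ hp
  rw [Valid, hk] at hv
  simp only [Holds] at hv
  obtain ⟨g, hg, hE⟩ := hv
  obtain ⟨F, hF⟩ := arityF_eq_some_iff.1 hC
  rw [h0, valid_Jn]; simp only [Holds]
  refine ⟨Term.func F g, ?_, ?_⟩
  · simp [PreTerm.ofTerm, hF, hg]
  · have h1 : ofNat (List ℕ) (jD (line.getI 1)) = List.ofFn fun i => encode (g i) := by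
      rw [← hE, Denumerable.ofNat_encode]
    have h2 : (List.ofFn fun i => encode (g i)).map (ofNat (List ℕ)) =
        List.ofFn fun i => termLetters (g i) := by
      rw [List.map_ofFn]
      congr 1
      funext i
      exact ofNat_encode_term (g i)
    rw [h1, h2, Denumerable.ofNat_encode, encode_term_eq, termLetters_func, hF]

/-- Soundness of `maNil`. [folklore] -/
theorem sound_maNil : RuleSound L S maNil := by
  intro prev line _ h
  simp only [maNil, Rule.ok, premsOK, eqsOK, Bool.true_and, Bool.and_true, beq_iff_eq, Tm.eval_jn,
    Tm.eval_fld, Tm.eval_cst] at h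
  rw [h, valid_Jn]; simp only [Holds]
  exact ⟨Fin.elim0, by simp, by simp⟩

/-- Soundness of `maCons`. [folklore] -/
theorem sound_maCons : RuleSound L S maCons := by
  intro prev line hprev h
  simp only [maCons, Rule.ok, premsOK, eqsOK, Bool.and_eq_true, Bool.true_and, Bool.and_true,
    decide_eq_true_eq, beq_iff_eq, Tm.eval_jn, Tm.eval_kd, Tm.eval_p1, Tm.eval_p2, Tm.eval_p3,
    Tm.eval_p4, Tm.eval_consT, Tm.eval_fld, Tm.eval_cst, Tm.eval_add, Tm.eval_lcons, and_assoc,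
    zero_add, Nat.reduceAdd] at h
  obtain ⟨hp, hq, hk, hk', hm, h0⟩ := h
  have hv := hprev _ hp
  rw [Valid, hk] at hv
  simp only [Holds] at hv
  have hw := hprev _ hq
  rw [Valid, hk'] at hw
  simp only [Holds] at hw
  rw [hm] at hw
  obtain ⟨t, ht, he⟩ := hv
  obtain ⟨g, hg, hE⟩ := hw
  rw [h0, valid_Jn]; simp only [Holds]
  refine ⟨Fin.cons t g, ?_, ?_⟩
  · simp [PreTerm.ofFn_succ, Fin.cons_zero, Fin.cons_succ, ht, hg]
  · rw [← hE, Denumerable.ofNat_encode, List.ofFn_succ]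
    simp [Fin.cons_zero, Fin.cons_succ, he]

/-- Soundness of `mlFalsum`. [folklore] -/
theorem sound_mlFalsum : RuleSound L S mlFalsum := by
  intro prev line _ h
  simp only [mlFalsum, Rule.ok, premsOK, eqsOK, Bool.true_and, Bool.and_true, beq_iff_eq,
    Tm.eval_jn, Tm.eval_lsing, Tm.eval_fld, Tm.eval_cst, Tm.eval_add, Tm.eval_mul] at h
  rw [h, valid_Jn]; simp only [Holds]
  exact ⟨BoundedFormula.falsum, by simp [PreFormula.ofBounded], by rw [formulaLetters_falsum]⟩

/-- Soundness of `mlEqual`. [folklore] -/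
theorem sound_mlEqual : RuleSound L S mlEqual := by
  intro prev line hprev h
  simp only [mlEqual, Rule.ok, premsOK, eqsOK, Bool.and_eq_true, Bool.true_and, Bool.and_true,
    decide_eq_true_eq, beq_iff_eq, Tm.eval_jn, Tm.eval_kd, Tm.eval_p1, Tm.eval_p2, Tm.eval_p3,
    Tm.eval_equalT, Tm.eval_lsing, Tm.eval_fld, Tm.eval_cst, Tm.eval_mul, Tm.eval_pair,
    Tm.eval_lcons, and_assoc, zero_add, Nat.reduceAdd] at h
  obtain ⟨hp, hq, hk, hk', hm, h0⟩ := h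
  have hv := hprev _ hp
  rw [Valid, hk] at hv
  simp only [Holds] at hv
  have hw := hprev _ hq
  rw [Valid, hk'] at hw
  simp only [Holds] at hw
  rw [hm] at hw
  obtain ⟨t₁, ht₁, he₁⟩ := hv
  obtain ⟨t₂, ht₂, he₂⟩ := hw
  rw [h0, valid_Jn]; simp only [Holds]
  refine ⟨BoundedFormula.equal t₁ t₂, by simp [PreFormula.ofBounded, ht₁, ht₂], ?_⟩
  rw [formulaLetters_equal, he₁, he₂]
  simp only [Denumerable.ofNat_encode]

/-- Soundness of the oracle rule `mlRel` (the oracle is the arity table `arityR L`). [folklore] -/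
theorem sound_mlRel (prev line : List ℕ) (hprev : ∀ p ∈ prev, Valid L S p)
    (h : mlRel.ok prev line = true) (hC : arityR L (line.getI 2) = some (jB (line.getI 1))) :
    Valid L S (line.getI 0) := by
  simp only [mlRel, Rule.ok, premsOK, eqsOK, Bool.and_eq_true, Bool.true_and, Bool.and_true,
    decide_eq_true_eq, beq_iff_eq, Tm.eval_jn, Tm.eval_kd, Tm.eval_p1, Tm.eval_p3, Tm.eval_p4,
    Tm.eval_relT, Tm.eval_fld, Tm.eval_cst, Tm.eval_add, Tm.eval_mul, Tm.eval_lcons,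
    Tm.eval_lmapArg, zero_add] at h
  obtain ⟨hp, hk, h0⟩ := h
  have hv := hprev _ hp
  rw [Valid, hk] at hv
  simp only [Holds] at hv
  obtain ⟨g, hg, hE⟩ := hv
  obtain ⟨R, hR⟩ := arityR_eq_some_iff.1 hC
  rw [h0, valid_Jn]; simp only [Holds]
  refine ⟨BoundedFormula.rel R g, ?_, ?_⟩
  · simp [PreFormula.ofBounded, hR, hg]
  · rw [formulaLetters_rel, hR, ← hE]
    simp only [Denumerable.ofNat_encode, List.map_ofFn]
    congr 3

/-- Soundness of `mlImp`. [folklore] -/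
theorem sound_mlImp : RuleSound L S mlImp := by
  intro prev line hprev h
  simp only [mlImp, Rule.ok, premsOK, eqsOK, Bool.and_eq_true, Bool.true_and, Bool.and_true,
    decide_eq_true_eq, beq_iff_eq, Tm.eval_jn, Tm.eval_kd, Tm.eval_p1, Tm.eval_p2, Tm.eval_p3,
    Tm.eval_impT, Tm.eval_fld, Tm.eval_cst, Tm.eval_lcons, Tm.eval_lappend, and_assoc, zero_add,
    Nat.reduceAdd] at h
  obtain ⟨hp, hq, hk, hk', hm, h0⟩ := h
  have hv := hprev _ hp
  rw [Valid, hk] at hv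
  simp only [Holds] at hv
  have hw := hprev _ hq
  rw [Valid, hk'] at hw
  simp only [Holds] at hw
  rw [hm] at hw
  obtain ⟨ψ₁, hψ₁, he₁⟩ := hv
  obtain ⟨ψ₂, hψ₂, he₂⟩ := hw
  rw [h0, valid_Jn]; simp only [Holds]
  refine ⟨BoundedFormula.imp ψ₁ ψ₂, by simp [PreFormula.ofBounded, hψ₁, hψ₂], ?_⟩
  rw [formulaLetters_imp, ← he₁, ← he₂]
  simp only [Denumerable.ofNat_encode]

/-- Soundness of `mlAll`. [folklore] -/
theorem sound_mlAll : RuleSound L S mlAll := by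
  intro prev line hprev h
  simp only [mlAll, Rule.ok, premsOK, eqsOK, Bool.and_eq_true, Bool.true_and, Bool.and_true,
    decide_eq_true_eq, beq_iff_eq, Tm.eval_jn, Tm.eval_kd, Tm.eval_p1, Tm.eval_p2, Tm.eval_p3,
    Tm.eval_allT, Tm.eval_fld, Tm.eval_cst, Tm.eval_add, Tm.eval_lcons, zero_add] at h
  obtain ⟨hp, hk, hm, h0⟩ := h
  have hv := hprev _ hp
  rw [Valid, hk] at hv
  simp only [Holds] at hv
  rw [hm] at hv
  obtain ⟨ψ, hψ, he⟩ := hv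
  rw [h0, valid_Jn]; simp only [Holds]
  refine ⟨BoundedFormula.all ψ, by simp [PreFormula.ofBounded, hψ], ?_⟩
  rw [formulaLetters_all, ← he]
  simp only [Denumerable.ofNat_encode]

/-- Soundness of `thm`. [folklore] -/
theorem sound_thm : RuleSound L S thm := by
  intro prev line hprev h
  simp only [thm, Rule.ok, premsOK, eqsOK, Bool.and_eq_true, Bool.true_and, Bool.and_true,
    decide_eq_true_eq, beq_iff_eq, Tm.eval_jn, Tm.eval_kd, Tm.eval_p1, Tm.eval_p2, Tm.eval_p3,
    Tm.eval_fld, Tm.eval_cst, and_assoc, zero_add, Nat.reduceAdd] at h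
  obtain ⟨hp, hq, hk, hk', hm, hx, h0⟩ := h
  have hv := hprev _ hp
  rw [Valid, hk] at hv
  simp only [Holds] at hv
  have hw := hprev _ hq
  rw [Valid, hk'] at hw
  simp only [Holds] at hw
  rw [hm, hx] at hw
  obtain ⟨ψ, hψ, he⟩ := hw
  rw [h0, valid_Jn]; simp only [Holds]
  refine ⟨ψ, by rw [encode_sentence_eq, he], ?_⟩
  rw [hψ]
  exact hv

/-- All pure rules are sound (for parameter-free hypotheses). [folklore] -/
theorem sound_pure (hS0 : ∀ ψ ∈ S, ψ.params = ∅) : ∀ r ∈ Rules.pure, RuleSound L S r := by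
  simp only [Rules.pure, List.forall_mem_cons]
  exact ⟨sound_ltVar, sound_ltParam, sound_ltFunc, sound_ltNil, sound_ltCons, sound_lfFalsum,
    sound_lfEqual, sound_lfRel, sound_lfImp, sound_lfAll, sound_itVar, sound_itParam, sound_itFunc,
    sound_itNil, sound_itCons, sound_ifFalsum, sound_ifEqual, sound_ifRel, sound_ifImp, sound_ifAll,
    sound_clParam, sound_clFunc, sound_clNil, sound_clCons, sound_ctParam, sound_ctFunc,
    sound_ntVar, sound_ntParam, sound_ntFunc, sound_ntNil, sound_ntCons, sound_nfFalsum,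
    sound_nfEqual, sound_nfRel, sound_nfImp, sound_nfAll, sound_pfP1, sound_pfP2, sound_pfP3,
    sound_pfQ1, sound_pfQ2, sound_pfQ3, sound_pfE1, sound_pfE2, sound_pfMP, sound_pfGen hS0,
    sound_mtVar, sound_maNil, sound_maCons, sound_mlFalsum, sound_mlEqual, sound_mlImp, sound_mlAll,
    sound_thm, fun _ h => by simp at h⟩

end RuleSoundness

/-! ### Soundness of the checker -/

section CheckerSoundness

variable {L : Language} [Encodable (Σ i, L.Functions i)] [Encodable (Σ i, L.Relations i)]
variable {S : Set PreFormula} {memA : ℕ → Bool}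

/-- **Soundness of the line check**: with the arity tables of `L` as symbol oracles, an axiom
oracle accepting (among Gödel numbers of sentences) only sentences translating into `S`, and `S`
parameter free, an accepted line carries a valid judgement if all earlier judgements are valid.
[folklore] -/
theorem lineOK_sound (hS0 : ∀ ψ ∈ S, ψ.params = ∅)
    (hA : ∀ ψ : L.Sentence, memA (encode ψ) = true → PreFormula.ofBounded ψ ∈ S)
    {prev line : List ℕ} (hprev : ∀ p ∈ prev, Valid L S p)
    (h : lineOK (arityF L) (arityR L) memA prev line = true) : Valid L S (line.getI 0) := by
  unfold lineOK at h
  simp only [Bool.or_eq_true, Bool.and_eq_true, decide_eq_true_eq] at h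
  rcases h with ((h | ⟨h, hC⟩) | ⟨h, hC⟩) | ⟨h, hC⟩
  · rw [anyOK_iff] at h
    obtain ⟨r, hr, hok⟩ := h
    exact sound_pure hS0 r hr prev line hprev hok
  · exact sound_mtFunc prev line hprev h hC
  · exact sound_mlRel prev line hprev h hC
  · exact sound_pfHyp hA prev line hprev h hC

/-- **Soundness of the certificate check**: every judgement of an accepted certificate is valid.
[folklore] -/
theorem certOK_sound (hS0 : ∀ ψ ∈ S, ψ.params = ∅)
    (hA : ∀ ψ : L.Sentence, memA (encode ψ) = true → PreFormula.ofBounded ψ ∈ S) :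
    ∀ (c : List (List ℕ)), certOK (arityF L) (arityR L) memA c = true →
      ∀ p ∈ heads c, Valid L S p := by
  intro c
  induction c using List.reverseRecOn with
  | nil => simp
  | append_singleton c l ih =>
      intro hc p hp
      rw [certOK_append_singleton, Bool.and_eq_true] at hc
      rw [heads_append, heads_singleton, List.mem_append, List.mem_singleton] at hp
      rcases hp with hp | rfl
      · exact ih hc.1 p hp
      · exact lineOK_sound hS0 hA (ih hc.1) hc.2

/-- **Soundness of the checker**: if some certificate for `n` is accepted, then `n` is the Gödel
number of a sentence whose translation is derivable from `S`. [folklore] -/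
theorem check_sound (hS0 : ∀ ψ ∈ S, ψ.params = ∅)
    (hA : ∀ ψ : L.Sentence, memA (encode ψ) = true → PreFormula.ofBounded ψ ∈ S)
    {n : ℕ} {c : List (List ℕ)} (h : check (arityF L) (arityR L) memA n c = true) :
    ∃ φ : L.Sentence, encode φ = n ∧ Provable S (PreFormula.ofBounded φ) := by
  rw [check, Bool.and_eq_true, decide_eq_true_eq] at h
  have hv := certOK_sound hS0 hA c h.1 _ h.2
  rwa [valid_Jn] at hv

end CheckerSoundness

end Literature.ModelTheory.ProofTheory.PreFOL
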